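import Mathlib
import Summits.Ventures.PercRepro2.HCovCubic
import Summits.Ventures.PercRepro2.HCovTyped
import Summits.Ventures.PercRepro2.TwoCopyBHK
import Summits.Ventures.PercRepro2.A3Inactive
import Summits.Ventures.PercRepro2.PendantRoot

/-!
# The typed bases with an inactive `a₃` ARE the two-copy cross counts (blind cell PercRepro2,
night-3 g3, 2026-08-24; the typed shadow of `A3Inactive.lean`)

Call `a₃` **inactive** when no configuration connects it to a root (`A3Inactive.lean`; e.g. an
isolated `a₃`). Then the three-copy kernel `K₃` of row 2′TRI collapses, copy by copy, onto the
two-copy cross-cluster kernel of `TwoCopyBHK.lean`: with `σ₃ ≡ 0` and `PD = Q`,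

  `K₃(x, y, w) + K₃(x, w, y) = 2 · 1_Q(x) · [K^{cross}_{b,o}(y, w) + K^{cross}_{o,b}(y, w)]`

(`K3_add_swap_of_inactive`; the first copy is a pure `Q`-spectator). Regrouping the typed count
by the spectator copy `x` (`typedCount_eq_sum_spec`, valid for EVERY kernel): the pairs `(y, w)`
completing `x` to a typed triple are exactly the complementary pairs on the spectator's free set
`G_x = {e ∈ F : τ e = [x e] + 1}` with the pinning `z_x` (`τ e = [x e] + 2` open, the other typed
edges closed, `z` off `F`) — a `pinnedCount` on the minor `(G_x, z_x)`. Hence, for an inactive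
`a₃` (`typedCount_eq_of_inactive`):

  `typedCount F z τ K₃ = Σ_{x = z off F} 1_Q(x) · [pinnedCount G_x z_x K^{cross}_{b,o} + pinnedCount G_x z_x K^{cross}_{o,b}]`,

and **`typedCount_nonneg_of_inactive`**: row 2′TRI holds on every instance with an inactive `a₃`
as soon as the two-colouring statement (BASE) — `CrossCount`, p1's `TwoCopyBHK.lean` — holds on
every minor in both orientations `(o, b)` and `(b, o)`; `TypedBases_of_inactive` is the row itself.
The `a₃`-active content of row 2′TRI (the `σ₃`- and `PD`-terms of `K₃`) is therefore exactly what
lies beyond the two-copy row, at the typed level too — the typed twin of mine-2's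
`HCov_of_a3Inactive` (which uses the WEIGHTED BHK inequality and is unconditional). Own code;
standard axioms; no outside source.
-/

namespace Summit.Ventures.PercRepro2

open UnionCluster

namespace CovForm

namespace TypedA3

/-! ## Regrouping a typed count by its first copy -/

section Regroup

variable {E : Type*} [Fintype E] [DecidableEq E] {R : Type*} [CommRing R]

/-- The free set of the spectator copy `x`: the typed edges the other two copies must split
(`τ e = [x e] + 1`). -/
def specFree (F : Finset E) (τ : E → ℕ) (x : Config E) : Finset E :=
  F.filter fun e => τ e = (x e).toNat + 1

/-- The pinning of the spectator copy `x` off its free set: on `F` the edges both other copies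
carry (`τ e = [x e] + 2`) are open and the other typed edges closed; off `F` the pinning `z`. -/
def specPin (F : Finset E) (z : Config E) (τ : E → ℕ) (x : Config E) : Config E :=
  fun e => if e ∈ F then decide (τ e = (x e).toNat + 2) else z e

omit [Fintype E] [DecidableEq E] in
/-- The spectator's free set is a subset of the typed set. -/
lemma specFree_subset (F : Finset E) (τ : E → ℕ) (x : Config E) : specFree F τ x ⊆ F :=
  Finset.filter_subset _ _

omit [Fintype E] [DecidableEq E] in
/-- Membership in the spectator's free set. -/
lemma mem_specFree {F : Finset E} {τ : E → ℕ} {x : Config E} {e : E} :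
    e ∈ specFree F τ x ↔ e ∈ F ∧ τ e = (x e).toNat + 1 := Finset.mem_filter

omit [Fintype E] in
/-- The spectator pinning off `F` is `z`. -/
lemma specPin_of_notMem {F : Finset E} {z : Config E} {τ : E → ℕ} {x : Config E} {e : E}
    (he : e ∉ F) : specPin F z τ x e = z e := by simp [specPin, he]

omit [Fintype E] in
/-- The spectator pinning on `F`: open iff both other copies carry the edge. -/
lemma specPin_of_mem {F : Finset E} {z : Config E} {τ : E → ℕ} {x : Config E} {e : E}
    (he : e ∈ F) : specPin F z τ x e = decide (τ e = (x e).toNat + 2) := by simp [specPin, he]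

omit [Fintype E] in
/-- The typed-triple condition on `(x, y, w)` says exactly: `y` agrees with the spectator pinning
off the spectator's free set, and `w` is the complement of `y` on it. -/
lemma cond_iff {F : Finset E} {z : Config E} {τ : E → ℕ} (hτ : ∀ e ∈ F, τ e = 1 ∨ τ e = 2)
    {x : Config E} (hx : ∀ e, e ∉ F → x e = z e) (y w : Config E) :
    ((∀ e, e ∉ F → x e = z e ∧ y e = z e ∧ w e = z e) ∧ (∀ e ∈ F, openCount x y w e = τ e)) ↔
      ((∀ e, e ∉ specFree F τ x → y e = specPin F z τ x e) ∧ w = flipOn (specFree F τ x) y) := by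
  constructor
  · rintro ⟨hA, hB⟩
    refine ⟨fun e he => ?_, funext fun e => ?_⟩
    · by_cases heF : e ∈ F
      · have hne : ¬ τ e = (x e).toNat + 1 := fun h => he (mem_specFree.2 ⟨heF, h⟩)
        have hB' := hB e heF
        have hτe := hτ e heF
        rw [specPin_of_mem heF]
        simp only [openCount] at hB'
        cases hxe : x e <;> cases hye : y e <;> cases hwe : w e <;>
          simp [hxe, hye, hwe] at hB' hne ⊢ <;> omega
      · rw [specPin_of_notMem heF]
        exact (hA e heF).2.1
    · by_cases heG : e ∈ specFree F τ x
      · rw [flipOn_of_mem _ _ heG]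
        obtain ⟨heF, hτe⟩ := mem_specFree.1 heG
        have hB' := hB e heF
        simp only [openCount] at hB'
        cases hxe : x e <;> cases hye : y e <;> cases hwe : w e <;>
          simp [hxe, hye, hwe] at hB' hτe ⊢ <;> omega
      · rw [flipOn_of_notMem _ _ heG]
        by_cases heF : e ∈ F
        · have hne : ¬ τ e = (x e).toNat + 1 := fun h => heG (mem_specFree.2 ⟨heF, h⟩)
          have hB' := hB e heF
          have hτe := hτ e heF
          simp only [openCount] at hB'
          cases hxe : x e <;> cases hye : y e <;> cases hwe : w e <;>
            simp [hxe, hye, hwe] at hB' hne ⊢ <;> omega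
        · rw [(hA e heF).2.2, (hA e heF).2.1]
  · rintro ⟨hP, rfl⟩
    refine ⟨fun e he => ⟨hx e he, ?_, ?_⟩, fun e heF => ?_⟩
    · have heG : e ∉ specFree F τ x := fun h => he (specFree_subset F τ x h)
      rw [hP e heG, specPin_of_notMem he]
    · have heG : e ∉ specFree F τ x := fun h => he (specFree_subset F τ x h)
      rw [flipOn_of_notMem _ _ heG, hP e heG, specPin_of_notMem he]
    · by_cases heG : e ∈ specFree F τ x
      · have hτe := (mem_specFree.1 heG).2
        simp only [openCount, flipOn_of_mem _ _ heG]
        cases hxe : x e <;> cases hye : y e <;> simp [hxe] at hτe ⊢ <;> omega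
      · have hne : ¬ τ e = (x e).toNat + 1 := fun h => heG (mem_specFree.2 ⟨heF, h⟩)
        have hτe := hτ e heF
        have hye := hP e heG
        rw [specPin_of_mem heF] at hye
        simp only [openCount, flipOn_of_notMem _ _ heG]
        cases hxe : x e <;> simp [hxe] at hye hne <;>
          rcases hτe with hτe | hτe <;> simp [hτe] at hye hne ⊢ <;> simp [hye]

/-- For a fixed spectator copy `x` (agreeing with `z` off `F`), the sum over the completing pairs
`(y, w)` is the complementary-pair count on the spectator's minor. -/
lemma inner_eq_pinnedCount {F : Finset E} {z : Config E} {τ : E → ℕ}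
    (hτ : ∀ e ∈ F, τ e = 1 ∨ τ e = 2) {x : Config E} (hx : ∀ e, e ∉ F → x e = z e)
    (K : Config E → Config E → Config E → R) :
    (∑ y : Config E, ∑ w : Config E,
        if (∀ e, e ∉ F → x e = z e ∧ y e = z e ∧ w e = z e) ∧ (∀ e ∈ F, openCount x y w e = τ e)
          then K x y w else 0) =
      pinnedCount (specFree F τ x) (specPin F z τ x) (K x) := by
  unfold pinnedCount
  refine Finset.sum_congr rfl fun y _ => ?_
  by_cases hP : ∀ e, e ∉ specFree F τ x → y e = specPin F z τ x e
  · rw [if_pos hP]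
    rw [Finset.sum_eq_single (flipOn (specFree F τ x) y)]
    · rw [if_pos ((cond_iff hτ hx y _).2 ⟨hP, rfl⟩)]
    · intro w _ hw
      rw [if_neg]
      intro h
      exact hw ((cond_iff hτ hx y w).1 h).2
    · intro h
      exact absurd (Finset.mem_univ _) h
  · rw [if_neg hP]
    refine Finset.sum_eq_zero fun w _ => ?_
    rw [if_neg]
    intro h
    exact hP ((cond_iff hτ hx y w).1 h).1

/-- **Regrouping by the spectator copy**: for every kernel `K`, the typed count over `F` is the
sum over the first copy `x` (agreeing with `z` off `F`) of the complementary-pair count of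
`K x` on the spectator's minor `(G_x, z_x)`. -/
theorem typedCount_eq_sum_spec (F : Finset E) (z : Config E) (τ : E → ℕ)
    (hτ : ∀ e ∈ F, τ e = 1 ∨ τ e = 2) (K : Config E → Config E → Config E → R) :
    typedCount F z τ K =
      ∑ x : Config E, if (∀ e, e ∉ F → x e = z e)
        then pinnedCount (specFree F τ x) (specPin F z τ x) (K x) else 0 := by
  unfold typedCount
  refine Finset.sum_congr rfl fun x _ => ?_
  by_cases hx : ∀ e, e ∉ F → x e = z e
  · rw [if_pos hx, inner_eq_pinnedCount hτ hx K]
  · rw [if_neg hx]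
    refine Finset.sum_eq_zero fun y _ => Finset.sum_eq_zero fun w _ => ?_
    rw [if_neg]
    rintro ⟨hA, -⟩
    exact hx fun e he => (hA e he).1

end Regroup

/-! ## The complementary-pair count is symmetric under swapping the two copies -/

section Swap

variable {E : Type*} [Fintype E] [DecidableEq E] {R : Type*} [CommRing R]

omit [Fintype E] in
/-- `flipOn G` is an involution. -/
lemma flipOn_flipOn' (G : Finset E) (x : Config E) : flipOn G (flipOn G x) = x := by
  funext e
  by_cases he : e ∈ G <;> simp [flipOn, he]

/-- Swapping the two arguments of the kernel does not change the complementary-pair count. -/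
lemma pinnedCount_swap (G : Finset E) (z : Config E) (K : Config E → Config E → R) :
    pinnedCount G z K = pinnedCount G z (fun y w => K w y) := by
  unfold pinnedCount
  have hinv : Function.Involutive (flipOn G) := fun x => flipOn_flipOn' G x
  rw [show (∑ x : Config E, if (∀ e, e ∉ G → x e = z e) then (fun y w => K w y) x (flipOn G x)
      else 0) = ∑ x : Config E, if (∀ e, e ∉ G → x e = z e) then K (flipOn G x) x else 0 from rfl]
  rw [← Equiv.sum_comp (Function.Involutive.toPerm (flipOn G) hinv)
    (fun x => if (∀ e, e ∉ G → x e = z e) then K (flipOn G x) x else 0)]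
  refine Finset.sum_congr rfl fun y _ => ?_
  have hP : (∀ e, e ∉ G → flipOn G y e = z e) ↔ (∀ e, e ∉ G → y e = z e) := by
    constructor
    · intro h e he; rw [← flipOn_of_notMem G y he]; exact h e he
    · intro h e he; rw [flipOn_of_notMem G y he]; exact h e he
  simp only [Function.Involutive.coe_toPerm, flipOn_flipOn', hP]

/-- The complementary-pair count is additive in the kernel. -/
lemma pinnedCount_add (G : Finset E) (z : Config E) (K K' : Config E → Config E → R) :
    pinnedCount G z (fun y w => K y w + K' y w) = pinnedCount G z K + pinnedCount G z K' := by
  unfold pinnedCount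
  rw [← Finset.sum_add_distrib]
  refine Finset.sum_congr rfl fun y _ => ?_
  split_ifs <;> simp

/-- Constants come out of the complementary-pair count. -/
lemma pinnedCount_const_mul (G : Finset E) (z : Config E) (c : R) (K : Config E → Config E → R) :
    pinnedCount G z (fun y w => c * K y w) = c * pinnedCount G z K := by
  unfold pinnedCount
  rw [Finset.mul_sum]
  refine Finset.sum_congr rfl fun y _ => ?_
  split_ifs <;> simp

/-- Pointwise equal kernels have equal complementary-pair counts. -/
lemma pinnedCount_congr (G : Finset E) (z : Config E) (K K' : Config E → Config E → R)
    (h : ∀ y w, K y w = K' y w) : pinnedCount G z K = pinnedCount G z K' := by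
  unfold pinnedCount
  simp only [h]

end Swap

/-! ## The kernel identity for an inactive `a₃` -/

section Kernel

variable {V : Type*} {E : Type*} {R : Type*} [Field R]

/-- `σ₃ ≡ 0` for an inactive `a₃`. -/
lemma sigma_a3_eq_zero {ends : E → Sym2 V} {a₁ a₂ a₃ : V}
    (hin : ∀ ω : Config E, ¬ Conn ends ω a₁ a₃ ∧ ¬ Conn ends ω a₂ a₃) (ω : Config E) :
    sigma (R := R) ends a₁ a₂ a₃ ω = 0 := by
  simp only [sigma, iL, iH]
  rw [Set.indicator_of_notMem, Set.indicator_of_notMem, sub_zero]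
  · exact fun h => (hin ω).2 (mem_connEvent.1 h)
  · exact fun h => (hin ω).1 (mem_connEvent.1 h)

/-- `1_PD = 1_Q` for an inactive `a₃`. -/
lemma iPD_eq_iQ {ends : E → Sym2 V} {a₁ a₂ a₃ : V}
    (hin : ∀ ω : Config E, ¬ Conn ends ω a₁ a₃ ∧ ¬ Conn ends ω a₂ a₃) :
    iPD (R := R) ends a₁ a₂ a₃ = iQ ends a₁ a₂ := by
  simp only [iPD, iQ, A3Inactive.PDEvent_eq_Q hin]

/-- **The kernel identity**: with an inactive `a₃`, the sum of `K₃` over the two orders of its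
last two arguments is twice the `Q`-indicator of the first copy times the sum of the two
cross-cluster kernels of the other two copies. -/
theorem K3_add_swap_of_inactive {ends : E → Sym2 V} {o a₁ a₂ a₃ b : V}
    (hin : ∀ ω : Config E, ¬ Conn ends ω a₁ a₃ ∧ ¬ Conn ends ω a₂ a₃) (x y w : Config E) :
    (K3 ends o a₁ a₂ a₃ b x y w : R) + K3 ends o a₁ a₂ a₃ b x w y =
      2 * iQ ends a₁ a₂ x *
        (crossKernel ends a₁ a₂ b o y w + crossKernel ends a₁ a₂ o b y w) := by
  have hσ : ∀ ω : Config E, sigma (R := R) ends a₁ a₂ a₃ ω = 0 := sigma_a3_eq_zero hin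
  unfold K3 sepKernel
  simp only [Fin.sum_univ_succ, Fin.sum_univ_zero, Matrix.cons_val_zero, Matrix.cons_val_succ,
    add_zero]
  unfold f3 f4 f5 f6 f7 f10 f11 f12
  simp only [hσ, iPD_eq_iQ (R := R) hin]
  unfold sigma inU iQ iL iH crossKernel
  rw [PendantRoot.avoidAll_eq_compl]
  ring

end Kernel

/-! ## The typed bases with an inactive `a₃` -/

section Main

variable {V : Type*} {E : Type*} [Fintype E] [DecidableEq E] [DecidableEq V] {R : Type*}
  [Field R] [LinearOrder R] [IsStrictOrderedRing R]

omit [DecidableEq V] in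
/-- **The typed count with an inactive `a₃` is a sum of two-copy cross counts**: one pair of
complementary-pair counts (both orientations of the cross kernel) on the minor of each spectator
copy, weighted by the spectator's `Q`-indicator. -/
theorem typedCount_eq_of_inactive {ends : E → Sym2 V} {o a₁ a₂ a₃ b : V}
    (hin : ∀ ω : Config E, ¬ Conn ends ω a₁ a₃ ∧ ¬ Conn ends ω a₂ a₃)
    (F : Finset E) (z : Config E) (τ : E → ℕ) (hτ : ∀ e ∈ F, τ e = 1 ∨ τ e = 2) :
    typedCount F z τ (K3 ends o a₁ a₂ a₃ b : Config E → Config E → Config E → R) =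
      ∑ x : Config E, if (∀ e, e ∉ F → x e = z e)
        then iQ ends a₁ a₂ x *
          (pinnedCount (specFree F τ x) (specPin F z τ x) (crossKernel ends a₁ a₂ b o) +
            pinnedCount (specFree F τ x) (specPin F z τ x) (crossKernel ends a₁ a₂ o b))
        else 0 := by
  rw [typedCount_eq_sum_spec F z τ hτ]
  refine Finset.sum_congr rfl fun x _ => ?_
  split_ifs with hx
  · set G := specFree F τ x
    set zx := specPin F z τ x
    have h2 : (2 : R) * pinnedCount G zx (K3 (R := R) ends o a₁ a₂ a₃ b x) =
        2 * (iQ ends a₁ a₂ x *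
          (pinnedCount G zx (crossKernel (R := R) ends a₁ a₂ b o) +
            pinnedCount G zx (crossKernel (R := R) ends a₁ a₂ o b))) := by
      have hs := pinnedCount_swap G zx (K3 (R := R) ends o a₁ a₂ a₃ b x)
      calc (2 : R) * pinnedCount G zx (K3 (R := R) ends o a₁ a₂ a₃ b x)
          = pinnedCount G zx (K3 (R := R) ends o a₁ a₂ a₃ b x) +
              pinnedCount G zx (fun y w => K3 (R := R) ends o a₁ a₂ a₃ b x w y) := by
            rw [← hs]; ring
        _ = pinnedCount G zx (fun y w => K3 (R := R) ends o a₁ a₂ a₃ b x y w +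
              K3 (R := R) ends o a₁ a₂ a₃ b x w y) := by
            rw [pinnedCount_add]
        _ = pinnedCount G zx (fun y w => (2 * iQ (R := R) ends a₁ a₂ x) *
              (crossKernel (R := R) ends a₁ a₂ b o y w +
                crossKernel (R := R) ends a₁ a₂ o b y w)) := by
            refine pinnedCount_congr _ _ _ _ fun y w => ?_
            exact K3_add_swap_of_inactive hin x y w
        _ = (2 * iQ (R := R) ends a₁ a₂ x) *
              (pinnedCount G zx (crossKernel (R := R) ends a₁ a₂ b o) +
                pinnedCount G zx (crossKernel (R := R) ends a₁ a₂ o b)) := by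
            rw [pinnedCount_const_mul, pinnedCount_add]
        _ = _ := by ring
    exact mul_left_cancel₀ (two_ne_zero : (2 : R) ≠ 0) h2
  · rfl

omit [Fintype E] [DecidableEq E] [DecidableEq V] in
/-- `1_Q ≥ 0`. -/
lemma iQ_nonneg (ends : E → Sym2 V) (a₁ a₂ : V) (x : Config E) :
    (0 : R) ≤ iQ ends a₁ a₂ x := by
  unfold iQ
  exact Set.indicator_nonneg (fun _ _ => zero_le_one) x

omit [DecidableEq V] in
/-- **Row 2′TRI with an inactive `a₃` from the two-colouring statement (BASE)** in both
orientations: every typed base of `K₃` is nonnegative. -/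
theorem typedCount_nonneg_of_inactive {ends : E → Sym2 V} {o a₁ a₂ a₃ b : V}
    (hin : ∀ ω : Config E, ¬ Conn ends ω a₁ a₃ ∧ ¬ Conn ends ω a₂ a₃)
    (hob : CrossCount R ends a₁ a₂ o b) (hbo : CrossCount R ends a₁ a₂ b o)
    (F : Finset E) (z : Config E) (τ : E → ℕ) (hτ : ∀ e ∈ F, τ e = 1 ∨ τ e = 2) :
    0 ≤ typedCount F z τ (K3 ends o a₁ a₂ a₃ b : Config E → Config E → Config E → R) := by
  rw [typedCount_eq_of_inactive hin F z τ hτ]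
  refine Finset.sum_nonneg fun x _ => ?_
  split_ifs
  · exact mul_nonneg (iQ_nonneg ends a₁ a₂ x) (add_nonneg (hbo _ _) (hob _ _))
  · exact le_rfl

omit [DecidableEq V] in
/-- **`TypedBases` with an inactive `a₃`** (row 2′TRI for the graph) from (BASE) on every minor in
both orientations. -/
theorem TypedBases_of_inactive {ends : E → Sym2 V} {o a₁ a₂ a₃ b : V}
    (hin : ∀ ω : Config E, ¬ Conn ends ω a₁ a₃ ∧ ¬ Conn ends ω a₂ a₃)
    (hob : CrossCount R ends a₁ a₂ o b) (hbo : CrossCount R ends a₁ a₂ b o) :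
    TypedBases (R := R) ends o a₁ a₂ a₃ b :=
  fun F z τ hτ => typedCount_nonneg_of_inactive hin hob hbo F z τ hτ

omit [DecidableEq V] in
/-- The isolated-`a₃` case: no edge at `a₃`, `a₃` distinct from the roots. -/
theorem TypedBases_of_isolated_a3 {ends : E → Sym2 V} {o a₁ a₂ a₃ b : V}
    (h3 : ∀ e, a₃ ∉ ends e) (h13 : a₁ ≠ a₃) (h23 : a₂ ≠ a₃)
    (hob : CrossCount R ends a₁ a₂ o b) (hbo : CrossCount R ends a₁ a₂ b o) :
    TypedBases (R := R) ends o a₁ a₂ a₃ b :=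
  TypedBases_of_inactive (A3Inactive.inactive_of_isolated h3 h13 h23) hob hbo

end Main

end TypedA3

end CovForm

end Summit.Ventures.PercRepro2
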